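import Literature.NumberTheory.EllipticCurves.KubotaLeopoldtTwoNumerator
import Literature.NumberTheory.EllipticCurves.BernoulliMeasureTransformProofs
import Literature.NumberTheory.EllipticCurves.PAdicBSD
import HarnessLib

/-!
# The `2`-adic Kubota–Leopoldt numerator `G_{θ,c}(T) = ∫_{ℤ₂^×}(1+T)^{ℓ(x)} d(θE_{1,c})(x)` of an ODD periodic `θ`
# — GL(1) analytic carriers of the cyclotomic line at `2` (crux `OrdLambdaHalfAtTwo`, item
# stmt-BirchSwinnertonDyer-19556, line `kato_determinant_greenberg_two`, v5 component D2, pen RC-351 (3))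

HONEST FRAMING.  Helper file (`--supports stmt-BirchSwinnertonDyer-19556 --as helper`); it proves NOTHING about an
elliptic curve and BSD is not proved by any of this.  In the tree's measure currency (`bernoulliMeasure`,
`distributionTransform`; `Literature/…/KubotaLeopoldtTwoNumerator.lean` is the case `θ = χ₋₄`, `c = 5`) it supplies the
GENERIC `2`-adic Kubota–Leopoldt numerator of a function `θ : ℤ/N → ℤ₂`: `twoKLMeasure θ c = θE_{1,c}`,
`twoKLNumerator θ c = G_{θ,c}`.  KERNEL: distribution relation and `‖·‖₂ ≤ 1` for `c` prime to `2N`; for ODD `θ` the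
measure is EVEN, so at `p = 2` (torsion `{±1}`) **`‖[T^k]G‖₂ ≤ ½`, `½G ∈ Λ = ℤ₂⟦T⟧`** (`halfLift`,
`iwasawaToPowerSeries_halfLift`); **`G(0) = (θE_{1,c})(ℤ₂) = (1 − θ(c)c)·B_{1,θ}`** (`constantCoeff_twoKLNumerator_eq`),
`B_{1,θ} = ∑_{i<N} θ(i)B₁(i/N)` (`bernoulliOne`); `X ∣ G ⟺ (1 − θ(c)c)B_{1,θ} = 0`, `T ∣ ½L ⟺ L(0) = 0`,
`½L` a unit `⟺ ‖L(0)‖₂ = ½` (the `λ`-handles `λ(T) = 1`, `λ(½·klTwoNumerator) = 0` are in `…GL1CycLineKLLambda`).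

Dictionary (PRINT, not asserted): Lang Ch. 4 §3 Thm. 3.2 / Washington §7.2 — for a Dirichlet character `χ` and
`θ = χω⁻¹ = χ·χ₋₄` on `ℤ₂^×`, `G_{θ,c}(5^s − 1) = −(1 − χ(c)⟨c⟩^{s+1})·L₂(−s, χ)`.  Gross (Invent. Math. 57 (1980);
Kriz 2016 Thm. 28; AT `p = 2`: Kriz–Li, Forum Math. Sigma 7 (2019) Lemma 7.6) factors Katz's `2`-adic `L`-function of
an imaginary quadratic `K` (2 split) on the CYCLOTOMIC line as `L₂(ε_Kω, s)·ζ₂(1 − s)`; the factors' numerators are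
`G_{ε_K𝟙_odd, c}` (companion file `…GL1CycLineKLQuad`, with the TRIVIAL ZERO `T ∣ G`) and `G_{χ₋₄,5} =
klTwoNumerator` (`λ(½G) = 0`; the pole of `ζ₂` is cancelled by the regulariser `1 − 5(1+T)`, `λ = 1`: a `λ`-shift
`−1`), each up to its regulariser `h_c = 1 − θ(c)ω(c)c(1+T)^{ℓ(c)}` (`λ(h_c) = 2^{ord₂ℓ(c)}`, `= 1` for `c ≡ 3,5 (8)`).
The tree's `GreenbergVatsal2000.IsCharacterLFunctionC/D` take `ZMod p`-valued characters, trivial at `p = 2`; hence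
this file.  No `sorry`, no named fact, no instance, no notation; axioms ⊆ {propext, Classical.choice, Quot.sound}.

References: [LangCyclotomic1990] Ch. 2 §2 (E_{1,c}, Thm. 2.1, 2.4), Ch. 4 §3 Thm. 3.2; [Washington1997] §7.1–7.2;
[MazurTateTeitelbaum1986Invent] §I.11–I.13; [Gross1980Factorization] B. H. Gross, Invent. Math. 57 (1980) 83–95;
[Kriz2016] Algebra Number Theory 10 (2016) Thm. 27–28; [KrizLi2019] Forum Math. Sigma 7 (2019) e15, Lemma 7.6.
-/

noncomputable section

open scoped Classical

open Filter Topology Finset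
open Literature.NumberTheory.EllipticCurves

set_option autoImplicit false
set_option linter.dupNamespace false

namespace Summit.BirchSwinnertonDyer.BirchSwinnertonDyer.Theorems.TwoAdicGL1CycLine

/-! ## §1 The measure `θE_{1,c}` and the numerator `G_{θ,c}` for a function `θ` on `ℤ/Nℤ` -/

section Generic

variable {N : ℕ} [NeZero N]

/-- `θ` read on the natural numbers through `ℕ → ℤ/Nℤ` (an `N`-periodic function, the `θ` of
`bernoulliMeasure`). [cite: LangCyclotomic1990, Ch. 2 §2 (a function on ℤ/Nℤ read on the integers, B 6–B 7)] -/
def charFun (θ : ZMod N → ℤ_[2]) : ℕ → ℤ_[2] := fun b ↦ θ (b : ZMod N)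

/-- **The measure `θE_{1,c}` on the `2`-power tower** (Lang Ch. 4 §3, the measure `χE_{1,c}` of the
Kubota–Leopoldt construction, here at `p = 2` for an arbitrary `θ : ℤ/Nℤ → ℤ₂`):
`μ(a + 2ⁿℤ₂) = ∑_{b mod N·2ⁿ, b ≡ a (2ⁿ)} θ(b) E_{1,c}^{(N·2ⁿ)}(b)` — the tree's `bernoulliMeasure 2 N c θ 1`.
[cite: LangCyclotomic1990, Ch. 4 §3 (the measure χE_{1,c}, PDF p. 84) and Ch. 2 §2 (E_{1,c}, PDF p. 35)] -/
def twoKLMeasure (θ : ZMod N → ℤ_[2]) (c : ℕ) : (n : ℕ) → ZMod (2 ^ n) → ℚ_[2] :=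
  bernoulliMeasure 2 N c (charFun θ) 1

/-- **The `2`-adic Kubota–Leopoldt numerator `G_{θ,c}(T) = ∫_{ℤ₂^×} (1+T)^{ℓ(x)} d(θE_{1,c})(x) ∈ ℚ₂⟦T⟧`**
(`⟨x⟩ = 5^{ℓ(x)}`; Mazur–Tate–Teitelbaum §I.13, Lang Ch. 4 §1 Example 2), the tree's `distributionTransform`
of `twoKLMeasure θ c`.  For `θ = χω⁻¹ = χ·χ₋₄` (`χ` a Dirichlet character) this is, by Lang Ch. 4 §3 Thm. 3.2,
the numerator of `L₂(−s, χ)`: `G(5^s − 1) = −(1 − χ(c)⟨c⟩^{s+1}) L₂(−s, χ)` (PRINT; not asserted here).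
[cite: MazurTateTeitelbaum1986Invent, §I.13] [cite: LangCyclotomic1990, Ch. 4 §1 Example 2 (PDF p. 79) and §3 Thm. 3.2 (PDF p. 84)] -/
def twoKLNumerator (θ : ZMod N → ℤ_[2]) (c : ℕ) : PowerSeries ℚ_[2] :=
  distributionTransform (twoKLMeasure θ c)

variable (θ : ZMod N → ℤ_[2]) (c : ℕ)

omit [NeZero N] in
/-- `charFun θ` has period `N`. [cite: LangCyclotomic1990, Ch. 2 §2 (B 6–B 7)] -/
theorem charFun_add_period (b : ℕ) : charFun θ (b + N) = charFun θ b := by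
  simp [charFun]

/-- Unfolding: `twoKLMeasure θ c = bernoulliMeasure 2 N c (charFun θ) 1`.
[cite: LangCyclotomic1990, Ch. 4 §3 (PDF p. 84)] -/
theorem twoKLMeasure_eq : twoKLMeasure θ c = bernoulliMeasure 2 N c (charFun θ) 1 := rfl

/-- `[T^k] G_{θ,c} = lim_n RS(k, n)` (unfolding). [cite: MazurTateTeitelbaum1986Invent, §I.13] -/
theorem coeff_twoKLNumerator (k : ℕ) :
    PowerSeries.coeff k (twoKLNumerator θ c) =
      limUnder atTop (distributionRiemannSum (twoKLMeasure θ c) k) :=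
  coeff_distributionTransform _ k

variable {θ c}

/-- **`θE_{1,c}` satisfies the distribution relation** on the `2`-power tower, for `c` prime to `2N`.
[cite: LangCyclotomic1990, Ch. 2 §2, E_{k,c} and Thm. 2.1 (PDF pp. 35–36)] -/
theorem twoKLMeasure_distribution (hc : c.Coprime (N * 2)) (n : ℕ) (a : ZMod (2 ^ n)) :
    ∑ b ∈ Finset.univ.filter (fun b : ZMod (2 ^ (n + 1)) ↦
        ZMod.castHom (pow_dvd_pow 2 n.le_succ) (ZMod (2 ^ n)) b = a), twoKLMeasure θ c (n + 1) b =
      twoKLMeasure θ c n a :=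
  sum_fiber_bernoulliMeasure hc (charFun_add_period θ) le_rfl n a

omit [NeZero N] in
/-- `c` prime to `2N` is odd. [folklore] -/
theorem odd_of_coprime (hc : c.Coprime (N * 2)) : Odd c :=
  Nat.coprime_two_right.mp (Nat.Coprime.coprime_mul_left_right hc)

/-- **`θE_{1,c}` is a measure: `‖μ(a + 2ⁿℤ₂)‖₂ ≤ 1`** for `c` prime to `2N` (`E_{1,c}^{(M)}(b) = (c−1)/2 − t ∈ ℤ`
for odd `c`, Lang Ch. 2 §2 Thm. 2.1 (i)). [cite: LangCyclotomic1990, Ch. 2 §2, Thm. 2.1 (i) (PDF p. 36)] -/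
theorem norm_twoKLMeasure_le_one (hc : c.Coprime (N * 2)) (n : ℕ) (a : ZMod (2 ^ n)) :
    ‖twoKLMeasure θ c n a‖ ≤ 1 :=
  norm_bernoulliMeasure_one_le_one_of_odd 2 hc (odd_of_coprime hc) n a

/-- `θE_{1,c}` vanishes on the non-unit (even) classes of positive level when `θ` vanishes on the even
integers. [cite: LangCyclotomic1990, Ch. 4 §3 (χ extended by 0, the measure lives on ℤ_p^*; PDF p. 84)] -/
theorem twoKLMeasure_eq_zero_of_not_isUnit (hθ2 : ∀ b : ℕ, 2 ∣ b → θ (b : ZMod N) = 0) {n : ℕ}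
    (hn : 1 ≤ n) (a : ZMod (2 ^ n)) (ha : ¬ IsUnit a) : twoKLMeasure θ c n a = 0 :=
  bernoulliMeasure_apply_eq_zero_of_not_isUnit (fun b h ↦ hθ2 b h) 1 hn a ha

/-- **The Riemann sums converge to the coefficients of `G_{θ,c}`.** [cite: MazurTateTeitelbaum1986Invent, §I.11–I.13] -/
theorem tendsto_distributionRiemannSum_twoKLMeasure (hc : c.Coprime (N * 2)) (k : ℕ) :
    Tendsto (distributionRiemannSum (twoKLMeasure θ c) k) atTop
      (𝓝 (PowerSeries.coeff k (twoKLNumerator θ c))) :=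
  tendsto_distributionRiemannSum (twoKLMeasure_distribution hc) (norm_twoKLMeasure_le_one hc) k

/-- **`‖[T^k] G_{θ,c}‖₂ ≤ 1`**: `G ∈ Λ ⊗ ℚ₂` with integral coefficients. [cite: MazurTateTeitelbaum1986Invent, §I.12] -/
theorem norm_coeff_twoKLNumerator_le_one (hc : c.Coprime (N * 2)) (k : ℕ) :
    ‖PowerSeries.coeff k (twoKLNumerator θ c)‖ ≤ 1 :=
  norm_coeff_distributionTransform_le (twoKLMeasure_distribution hc) (norm_twoKLMeasure_le_one hc) k

/-! ### Evenness: for odd `θ`, `θE_{1,c}` is even, so `½G ∈ Λ` at `p = 2` -/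

/-- The reduction of `b ∈ ℤ/N·2ⁿ` to `ℤ/N` is its `val` read modulo `N`. [folklore] -/
private theorem natCast_val_eq_castHom (n : ℕ) (b : ZMod (N * 2 ^ n)) :
    ((b.val : ℕ) : ZMod N) = ZMod.castHom (Dvd.intro _ rfl) (ZMod N) b := by
  haveI : NeZero (N * 2 ^ n) := ⟨mul_ne_zero (NeZero.ne N) (pow_ne_zero _ two_ne_zero)⟩
  rw [ZMod.castHom_apply, ZMod.cast_eq_val]

/-- The summand `θ(b)E_{1,c}^{(N·2ⁿ)}(b)` of `twoKLMeasure` is an even function of `b ∈ ℤ/N·2ⁿ` when `θ` is odd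
(odd × odd). [cite: LangCyclotomic1990, Ch. 2 §2 (E_{1,c} odd: B 2, PDF pp. 39–41) and Ch. 4 §3 (PDF p. 84)] -/
private theorem summand_neg (hc : c.Coprime (N * 2)) (hodd : ∀ x : ZMod N, θ (-x) = -θ x) (n : ℕ)
    (b : ZMod (N * 2 ^ n)) :
    ((charFun θ (-b).val : ℤ_[2]) : ℚ_[2]) *
        ((regBernoulliDist 1 (N * 2 ^ n) c (-b) / ((1 : ℕ) : ℚ) : ℚ) : ℚ_[2]) =
      ((charFun θ b.val : ℤ_[2]) : ℚ_[2]) *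
        ((regBernoulliDist 1 (N * 2 ^ n) c b / ((1 : ℕ) : ℚ) : ℚ) : ℚ_[2]) := by
  haveI : NeZero (N * 2 ^ n) := ⟨mul_ne_zero (NeZero.ne N) (pow_ne_zero _ two_ne_zero)⟩
  rcases eq_or_ne b 0 with rfl | hb
  · rw [neg_zero]
  have hc' : c.Coprime (N * 2 ^ n) :=
    Nat.Coprime.mul_right (Nat.Coprime.coprime_mul_right_right hc)
      (Nat.Coprime.pow_right _ (Nat.Coprime.coprime_mul_left_right hc))
  have hθ : charFun θ (-b).val = -charFun θ b.val := by
    simp only [charFun, natCast_val_eq_castHom, map_neg, hodd]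
  rw [hθ, regBernoulliDist_one_neg hc' hb]
  push_cast
  ring

/-- **For odd `θ` the measure `θE_{1,c}` is even**: `μ(−a + 2ⁿℤ₂) = μ(a + 2ⁿℤ₂)`.
[cite: LangCyclotomic1990, Ch. 2 §2 (E_{1,c}, B 2; PDF pp. 39–41) and Ch. 4 §3 (χE_{1,c}, PDF p. 84)] -/
theorem twoKLMeasure_neg (hc : c.Coprime (N * 2)) (hodd : ∀ x : ZMod N, θ (-x) = -θ x) (n : ℕ)
    (a : ZMod (2 ^ n)) : twoKLMeasure θ c n (-a) = twoKLMeasure θ c n a := by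
  rw [twoKLMeasure_eq]
  unfold bernoulliMeasure
  rw [Finset.sum_filter, Finset.sum_filter]
  conv_lhs => rw [← Equiv.sum_comp (Equiv.neg (ZMod (N * 2 ^ n)))]
  refine Finset.sum_congr rfl fun b _ ↦ ?_
  simp only [Equiv.neg_apply, map_neg, neg_inj]
  split_ifs
  · exact summand_neg hc hodd n b
  · rfl

/-- **`‖[T^k] G_{θ,c}‖₂ ≤ ½` for odd `θ`: `G ∈ 2Λ`, i.e. `½G ∈ ℤ₂⟦T⟧`** (the `η = ±1` halves of every Riemann
sum agree at `p = 2`). [cite: MazurTateTeitelbaum1986Invent, §I.12–I.13 (p = 2)] -/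
theorem norm_coeff_twoKLNumerator_le_half (hc : c.Coprime (N * 2)) (hodd : ∀ x : ZMod N, θ (-x) = -θ x)
    (k : ℕ) : ‖PowerSeries.coeff k (twoKLNumerator θ c)‖ ≤ 2⁻¹ := by
  have h := norm_coeff_distributionTransform_le_half_of_even (twoKLMeasure_neg hc hodd)
    (twoKLMeasure_distribution hc) (norm_twoKLMeasure_le_one hc) k
  rw [one_div] at h
  exact h

/-! ### The constant term is the total mass `(θE_{1,c})(ℤ₂) = (1 − θ(c)c)·B_{1,θ}` -/

/-- For a distribution on the `2`-power tower, the sum of the values at level `n` is the value at level `0`.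
[cite: LangCyclotomic1990, Ch. 2 §2 (distribution relation, PDF p. 34)] -/
private theorem sum_level_eq_zero_level {μ : (n : ℕ) → ZMod (2 ^ n) → ℚ_[2]}
    (hdist : ∀ (n : ℕ) (a : ZMod (2 ^ n)),
      ∑ b ∈ Finset.univ.filter (fun b : ZMod (2 ^ (n + 1)) ↦
        ZMod.castHom (pow_dvd_pow 2 n.le_succ) (ZMod (2 ^ n)) b = a), μ (n + 1) b = μ n a)
    (n : ℕ) : ∑ b : ZMod (2 ^ n), μ n b = μ 0 0 := by
  induction n with
  | zero =>
      haveI : Subsingleton (ZMod (2 ^ 0)) := ZMod.subsingleton_iff.2 (by norm_num)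
      exact Fintype.sum_subsingleton _ 0
  | succ n ih =>
      rw [← ih, ← Finset.sum_fiberwise Finset.univ
        (ZMod.castHom (pow_dvd_pow 2 n.le_succ) (ZMod (2 ^ n))) (μ (n + 1))]
      exact Finset.sum_congr rfl fun a _ ↦ hdist n a

/-- **`G_{θ,c}(0) = (θE_{1,c})(ℤ₂)`** when `θ` vanishes on the even integers: the constant term of the transform
is the mass of the units `μ(1 + 4ℤ₂) + μ(3 + 4ℤ₂)` (MTT §I.13), the even classes carry no mass, and the
distribution relation sums the level-`2` values to the total mass. [cite: MazurTateTeitelbaum1986Invent, §I.13]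
[cite: LangCyclotomic1990, Ch. 4 §3 (∫_{ℤ_p} = ∫_{ℤ_p^*} for χ extended by 0, PDF p. 84)] -/
theorem constantCoeff_twoKLNumerator_eq_mass (hc : c.Coprime (N * 2))
    (hθ2 : ∀ b : ℕ, 2 ∣ b → θ (b : ZMod N) = 0) :
    PowerSeries.constantCoeff (twoKLNumerator θ c) = twoKLMeasure θ c 0 0 := by
  rw [twoKLNumerator, constantCoeff_distributionTransform (twoKLMeasure_distribution hc),
    ← sum_level_eq_zero_level (twoKLMeasure_distribution hc) (cyclotomicExponent 2)]
  haveI : NeZero (2 ^ cyclotomicExponent 2) := ⟨pow_ne_zero _ two_ne_zero⟩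
  rw [sum_units_eq_sum_filter_isUnit (F := fun a ↦ twoKLMeasure θ c (cyclotomicExponent 2) a),
    Finset.sum_filter]
  refine Finset.sum_congr rfl fun a _ ↦ ?_
  split_ifs with ha
  · rfl
  · exact (twoKLMeasure_eq_zero_of_not_isUnit hθ2
      (Nat.pos_of_ne_zero (cyclotomicExponent_ne_zero 2)) a ha).symm

/-- **The generalised first Bernoulli number `B_{1,θ} = ∑_{i<N} θ(i)·B₁(i/N)`** of the `N`-periodic function
`θ` (`B₁(X) = X − ½`; Lang Ch. 2 §2, **B 7** with `k = 1`), in `ℚ₂`.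
[cite: LangCyclotomic1990, Ch. 2 §2, B 6–B 7 (PDF p. 35)] -/
def bernoulliOne (θ : ZMod N → ℤ_[2]) : ℚ_[2] :=
  ∑ i ∈ Finset.range N, ((θ (i : ZMod N) : ℤ_[2]) : ℚ_[2]) *
    (((Polynomial.bernoulli 1).eval ((i : ℚ) / N) : ℚ) : ℚ_[2])

/-- **Total mass `(θE_{1,c})(ℤ₂) = (1 − θ(c)c)·B_{1,θ}`** for `θ` multiplicative with respect to `c` (Lang
Ch. 2 §2 Thm. 2.4 at `k = 1`: `∫ ψ dE_{1,c} = (1 − ψ(c)c)B_{1,ψ}`).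
[cite: LangCyclotomic1990, Ch. 2 §2, Thm. 2.4 and its proof (PDF p. 38)] -/
theorem twoKLMeasure_zero_zero_eq (hc : c.Coprime (N * 2))
    (hmul : ∀ x : ℕ, θ ((c * x : ℕ) : ZMod N) = θ (c : ZMod N) * θ (x : ZMod N)) :
    twoKLMeasure θ c 0 0 =
      (1 - ((θ (c : ZMod N) : ℤ_[2]) : ℚ_[2]) * (c : ℚ_[2])) * bernoulliOne θ := by
  rw [twoKLMeasure_eq, bernoulliMeasure_zero_eq 2 hc (charFun_add_period θ) (fun x ↦ hmul x) 1,
    sum_bernoulliDist_level_zero_eq 2 (charFun θ) 1]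
  simp only [Nat.cast_one, inv_one, one_mul, pow_one, Nat.sub_self, pow_zero, bernoulliOne, charFun]

/-- **`G_{θ,c}(0) = (1 − θ(c)c)·B_{1,θ}`** for `θ` vanishing on the even integers and multiplicative with respect
to `c`, `c` prime to `2N`. [cite: LangCyclotomic1990, Ch. 2 §2 Thm. 2.4 (PDF p. 38) and Ch. 4 §3 Thm. 3.2 (PDF p. 84)]
[cite: MazurTateTeitelbaum1986Invent, §I.13] -/
theorem constantCoeff_twoKLNumerator_eq (hc : c.Coprime (N * 2))
    (hθ2 : ∀ b : ℕ, 2 ∣ b → θ (b : ZMod N) = 0)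
    (hmul : ∀ x : ℕ, θ ((c * x : ℕ) : ZMod N) = θ (c : ZMod N) * θ (x : ZMod N)) :
    PowerSeries.constantCoeff (twoKLNumerator θ c) =
      (1 - ((θ (c : ZMod N) : ℤ_[2]) : ℚ_[2]) * (c : ℚ_[2])) * bernoulliOne θ := by
  rw [constantCoeff_twoKLNumerator_eq_mass hc hθ2, twoKLMeasure_zero_zero_eq hc hmul]

/-- **The numerator is divisible by `T` iff `(1 − θ(c)c)·B_{1,θ} = 0`** (a power series is divisible by the
variable iff its constant term vanishes).  The source of the TRIVIAL ZERO at `2` of the companion file.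
[cite: LangCyclotomic1990, Ch. 4 §3 Thm. 3.2 (PDF p. 84)] -/
theorem X_dvd_twoKLNumerator_iff (hc : c.Coprime (N * 2))
    (hθ2 : ∀ b : ℕ, 2 ∣ b → θ (b : ZMod N) = 0)
    (hmul : ∀ x : ℕ, θ ((c * x : ℕ) : ZMod N) = θ (c : ZMod N) * θ (x : ZMod N)) :
    (PowerSeries.X : PowerSeries ℚ_[2]) ∣ twoKLNumerator θ c ↔
      (1 - ((θ (c : ZMod N) : ℤ_[2]) : ℚ_[2]) * (c : ℚ_[2])) * bernoulliOne θ = 0 := by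
  rw [PowerSeries.X_dvd_iff, constantCoeff_twoKLNumerator_eq hc hθ2 hmul]

end Generic

/-! ## §2 `½L ∈ Λ`: the integral half-lift of a series in `2·ℤ₂⟦T⟧`, and its `λ`-handle -/

section HalfLift

/-- `‖2‖₂ = ½`. [cite: MazurTateTeitelbaum1986Invent, §I.12 (unfolding)] -/
private theorem norm_two_eq_half : ‖(2 : ℚ_[2])‖ = 2⁻¹ := by
  have h := @Padic.norm_p 2 _
  push_cast at h
  exact h

/-- `‖½·x‖₂ ≤ 1` when `‖x‖₂ ≤ ½`. [cite: MazurTateTeitelbaum1986Invent, §I.12 (unfolding)] -/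
private theorem norm_half_mul_le_one {x : ℚ_[2]} (hx : ‖x‖ ≤ 2⁻¹) : ‖(2⁻¹ : ℚ_[2]) * x‖ ≤ 1 := by
  rw [norm_mul, norm_inv, norm_two_eq_half, inv_inv]
  calc (2 : ℝ) * ‖x‖ ≤ 2 * 2⁻¹ := mul_le_mul_of_nonneg_left hx (by norm_num)
    _ = 1 := by norm_num

/-- **The integral half-lift `½L ∈ Λ = ℤ₂⟦T⟧`** of a series `L ∈ ℚ₂⟦T⟧` with `‖[T^k]L‖₂ ≤ ½` for all `k`
(coefficientwise division by `2`; MTT §I.12: `Λ ⊗ ℚ` = bounded series; Washington §7.2 divides the `2`-adic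
Kubota–Leopoldt series by `2`). [cite: MazurTateTeitelbaum1986Invent, §I.12] [cite: Washington1997, §7.2 (p = 2)] -/
def halfLift (L : PowerSeries ℚ_[2]) (hL : ∀ k : ℕ, ‖PowerSeries.coeff k L‖ ≤ 2⁻¹) : IwasawaAlgebra 2 :=
  PowerSeries.mk fun k ↦ ⟨(2⁻¹ : ℚ_[2]) * PowerSeries.coeff k L, norm_half_mul_le_one (hL k)⟩

variable {L : PowerSeries ℚ_[2]} (hL : ∀ k : ℕ, ‖PowerSeries.coeff k L‖ ≤ 2⁻¹)

/-- The `k`-th coefficient of `½L` is `½·[T^k]L`. [cite: MazurTateTeitelbaum1986Invent, §I.12 (unfolding)] -/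
theorem coe_coeff_halfLift (k : ℕ) :
    ((PowerSeries.coeff k (halfLift L hL) : ℤ_[2]) : ℚ_[2]) = (2⁻¹ : ℚ_[2]) * PowerSeries.coeff k L := by
  rw [halfLift, PowerSeries.coeff_mk]

/-- **`ι(½L) = ½·L` in `ℚ₂⟦T⟧`** (`ι = iwasawaToPowerSeries 2 : Λ ↪ ℚ₂⟦T⟧`).
[cite: MazurTateTeitelbaum1986Invent, §I.12] -/
theorem iwasawaToPowerSeries_halfLift :
    iwasawaToPowerSeries 2 (halfLift L hL) = PowerSeries.C (2⁻¹ : ℚ_[2]) * L := by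
  ext k
  rw [PowerSeries.coeff_C_mul, iwasawaToPowerSeries, PowerSeries.coeff_map, ← coe_coeff_halfLift hL k]
  rfl

/-- `L = 2·ι(½L)`. [cite: MazurTateTeitelbaum1986Invent, §I.12] -/
theorem eq_two_mul_iwasawaToPowerSeries_halfLift :
    L = PowerSeries.C (2 : ℚ_[2]) * iwasawaToPowerSeries 2 (halfLift L hL) := by
  rw [iwasawaToPowerSeries_halfLift, ← mul_assoc, ← map_mul, mul_inv_cancel₀ two_ne_zero, map_one,
    one_mul]

/-- `(½L)(0) = ½·L(0)`. [cite: MazurTateTeitelbaum1986Invent, §I.12 (unfolding)] -/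
theorem coe_constantCoeff_halfLift :
    ((PowerSeries.constantCoeff (halfLift L hL) : ℤ_[2]) : ℚ_[2]) =
      (2⁻¹ : ℚ_[2]) * PowerSeries.constantCoeff L := by
  rw [← PowerSeries.coeff_zero_eq_constantCoeff_apply, ← PowerSeries.coeff_zero_eq_constantCoeff_apply,
    coe_coeff_halfLift]

/-- **`T ∣ ½L` in `Λ` iff `L(0) = 0`.** [cite: MazurTateTeitelbaum1986Invent, §I.12] -/
theorem X_dvd_halfLift_iff :
    (PowerSeries.X : IwasawaAlgebra 2) ∣ halfLift L hL ↔ PowerSeries.constantCoeff L = 0 := by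
  rw [PowerSeries.X_dvd_iff]
  constructor
  · intro h
    have h' := coe_constantCoeff_halfLift hL
    rw [h, PadicInt.coe_zero] at h'
    have h2 : (2⁻¹ : ℚ_[2]) ≠ 0 := inv_ne_zero two_ne_zero
    exact (mul_eq_zero.mp h'.symm).resolve_left h2
  · intro h
    have h' := coe_constantCoeff_halfLift hL
    rw [h, mul_zero] at h'
    exact PadicInt.coe_eq_zero.mp h'

/-- **`½L` is a unit of `Λ` iff `‖L(0)‖₂ = ½`** (a power series over the local ring `ℤ₂` is a unit iff its
constant term is; `‖½·L(0)‖₂ = 1 ⟺ ‖L(0)‖₂ = ½`). [cite: Washington1997, §7.1 (units of Λ)] -/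
theorem isUnit_halfLift_iff :
    IsUnit (halfLift L hL) ↔ ‖PowerSeries.constantCoeff L‖ = 2⁻¹ := by
  rw [PowerSeries.isUnit_iff_constantCoeff, PadicInt.isUnit_iff]
  have h : ‖PowerSeries.constantCoeff (halfLift L hL)‖ = 2 * ‖PowerSeries.constantCoeff L‖ := by
    rw [PadicInt.norm_def, coe_constantCoeff_halfLift, norm_mul, norm_inv, norm_two_eq_half, inv_inv]
  rw [h]
  constructor
  · intro h1
    linarith
  · intro h1
    rw [h1]
    norm_num

end HalfLift

end Summit.BirchSwinnertonDyer.BirchSwinnertonDyer.Theorems.TwoAdicGL1CycLine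

end
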